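import Literature.InformationTheory.QuantumCodes.QuantumExpanderLTZLemma8
import Literature.InformationTheory.QuantumCodes.SmallSetFlipLocality
import HarnessLib

/-!
# Quantum expander codes: LTZ15 Lemma 8 WITH ITS REDUCED-WEIGHT CLAUSE — what survives for unbalanced
# degrees (qec finding E-7) — PROOF

Index of sources: `[cite: LeverrierTillichZemor2015]` = Leverrier–Tillich–Zémor, FOCS 2015 / arXiv:1504.00822v1:
Lemma 8 (p0008 L104-114: "… there exists a critical generator together with a vector `e₁` whose support is included
in the generator, such that `|σ_X(e)| − |σ_X(e+e₁)| ≥ |e₁|/3`. … Moreover, `w_R(e+e₁) ≤ w_R(e)`."), its proof App. B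
(p0013 L10 – p0014 L65; the four cases; clause (ii) "the reduced weight `w_R(e+e₁)` is at most equal to the Hamming
weight `|e|` of `e`"), and Cor 9 (p0009 L9-31), whose proof is the only consumer of clause (ii).

qec PARTITION v2 row 04 (`prover-qec-type-04`, gen 6), item «E-7 repair as mathematics». CONTEXT (finding E-7, confirmed
by a second reader): in case 4 of App. B, branch `max{∂, ∂̄} = ∂̄`, the text says "`w_R(e+e₁) ≤ |e|` by the same argument
as in case 3"; that argument needs `|χ_a| + |χ_b| ≤ |x_a| + |x_b|`, which follows when `Δ_A = Δ_B` but not in general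
(explicit integer configurations violate it). This file proves what DOES hold, with the printed constant `1/3`:

* `ltz_four_cases_weight` — the App. B arithmetic with the weight bookkeeping added: either the flip `x_a ∪ x_b ⊆ E`
  has decrease `≥ |x_a ∪ x_b|/3`, or one of `x̄_a ∪ x̄_b` / its complement has decrease `Q ≥` (its size)`/3` AND the
  weight deficit `c = |χ_a| + |χ_b| − |x_a| − |x_b|` of the representative `e + 𝟙(x_a ∪ x_b ∪ χ_a ∪ χ_b)` satisfies
  `3c ≤ 6Q − 6` (always) and `3c + 2 < |Δ_A − Δ_B|` (so `c ≤ 0` whenever `|Δ_A − Δ_B| ≤ 5`);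
* `exists_smallSet_decrease_third_weight` — **LTZ15 Lemma 8, both clauses, in the form that is true for all degrees**:
  for `e ∉ C_Z^⊥` with `|e| ≤ γ_A n_A`, `|e| ≤ γ_B n_B` there are a small set `F` and a word `e' ≡ e + 𝟙_F (mod C_Z^⊥)`
  with (i) `|F| ≤ 3·(|σ_X(e)| − |σ_X(e + 𝟙_F)|)`, (ii-weak) `|e'| ≤ |e| + 2·(|σ_X(e)| − |σ_X(e+𝟙_F)|) − 2`, and
  (ii, as printed) `|e'| ≤ |e|` PROVIDED `|Δ_A − Δ_B| ≤ 5` — in particular for balanced degrees `Δ_A = Δ_B`, the case of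
  every example in LTZ15 and FGL18. With `e` a minimum-weight representative this is `w_R(e+e₁) ≤ w_R(e)`.

HONEST FRAMING: (ii-weak) and the hypothesis `|Δ_A − Δ_B| ≤ 5` are OURS (the repair), not the paper's; the decrease
clause (i) is the tree's `exists_smallSet_decrease_third` (all degrees) and is re-proved here only because the flip and
the weight witness must be produced together. Why no better local repair exists (no choice of `e₁ ⊆ g_{ba}` rescues the
printed clause for all unbalanced degrees from the information App. B uses) is recorded in the qec cell's E-7 note, not
here. PROVED (kernel axioms); no definitions, no named facts.
-/

namespace Literature.InformationTheory.QuantumCodes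

namespace QuantumExpander

open Finset Matrix

variable {A B : Type*} [Fintype A] [Fintype B] [DecidableEq A] [DecidableEq B]

/-! ### The four cases of App. B with the weight bookkeeping -/

/-- **The arithmetic of LTZ15 App. B with the reduced-weight bookkeeping.** Variables as in the tree's
`ltz_four_cases` (`X = |x_a|`, `Xb = |x̄_a|`, `Za = |χ_a|`, `X + Xb + Za = Δ_B`; `Y = |x_b|`, `Yb = |x̄_b|`, `Zb = |χ_b|`,
`Y + Yb + Zb = Δ_A`; `P ≥` eq. (partial), `Q ≥` eq. (partial2); integrality `3|χ_a| + 1 ≤ Δ_B`, `3|χ_b| + 1 ≤ Δ_A`;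
eq. (reduced) `2|x_a ∪ x_b| ≤ Δ_A + Δ_B`), plus `x_a ∪ x_b ≠ ∅` (Def. 6). Conclusion: EITHER the flip `x_a ∪ x_b` (inside `E`) has `|x_a ∪ x_b| ≤ 3P` (cases 1, 2 and the
`∂`-branch of case 4), OR (case 3 and the `∂̄`-branch of case 4) one of `x̄_a ∪ x̄_b`, its complement has size `≤ 3Q`, and
the weight deficit `c = Za + Zb − X − Y` of the representative `e + 𝟙(x_a ∪ x_b ∪ χ_a ∪ χ_b)` obeys `3c ≤ 6Q − 6` and
`3c + 2 < |Δ_A − Δ_B|`. (Case 3: `x > x̄`, `y > ȳ` force `X > Za + ½`, `Y > Zb + ½`, so `c < −1`; case 4: `6Q ≥ Δ_A+Δ_B+1`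
while `3c ≤ Δ_A + Δ_B − 5`, and "not case 1" gives `3(X+Y) > 2 min(Δ_A,Δ_B)`, whence `3c < |Δ_A−Δ_B| − 2`.) STATUS: the case
analysis and the first alternative are the paper's; the two deficit bounds are OURS (finding E-7 bookkeeping), not printed.
[cite: LeverrierTillichZemor2015, App. B, the four cases and clause (ii) (arXiv v1 p0013 L36-44, L91-149, p0014 L1-65)] -/
theorem ltz_four_cases_weight {dA dB X Xb Za Y Yb Zb P Q : ℝ} (hdA : 0 < dA) (hdB : 0 < dB)
    (hX : 0 ≤ X) (hXb : 0 ≤ Xb) (hY : 0 ≤ Y) (hYb : 0 ≤ Yb)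
    (hrow : X + Xb + Za = dB) (hcol : Y + Yb + Zb = dA)
    (hZa3 : 3 * Za + 1 ≤ dB) (hZb3 : 3 * Zb + 1 ≤ dA) (hred : 2 * (X + Y) ≤ dA + dB)
    (hpos : 1 ≤ X + Y)
    (hP : X * Yb + Xb * Y - X * Zb - Za * Y ≤ P) (hQ : X * Yb + Xb * Y - Xb * Zb - Za * Yb ≤ Q) :
    X + Y ≤ 3 * P ∨
      ((Xb + Yb ≤ 3 * Q ∨ dA + dB - Xb - Yb ≤ 3 * Q) ∧ 3 * (Za + Zb - X - Y) ≤ 6 * Q - 6 ∧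
        3 * (Za + Zb - X - Y) + 2 < |dA - dB|) := by
  by_cases h1 : 3 * (X * dA + Y * dB) ≤ 2 * (dA * dB)
  · -- Case 1 (`x + y ≤ 2/3`): flip `x_a ∪ x_b` (the arithmetic of the tree's `ltz_four_cases`, case 1)
    left
    have hYb' : Yb = dA - Y - Zb := by linarith
    have hXb' : Xb = dB - X - Za := by linarith
    have hP' : X * dA + Y * dB - 2 * X * Y - 2 * X * Zb - 2 * Za * Y ≤ P := by
      rw [hYb', hXb'] at hP; linarith
    have hS0 : 0 ≤ X * dA + Y * dB := by positivity
    have hxy : 2 * X * Y ≤ (X * dA + Y * dB) / 3 := by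
      have hd : 0 < dA * dB := mul_pos hdA hdB
      have hsq : (X * dA + Y * dB) ^ 2 ≤ 2 * (dA * dB) / 3 * (X * dA + Y * dB) := by
        have := mul_le_mul_of_nonneg_left h1 hS0
        nlinarith
      have h4 : 4 * (X * Y) * (dA * dB) ≤ 2 * (dA * dB) / 3 * (X * dA + Y * dB) := by
        nlinarith [sq_nonneg (X * dA - Y * dB)]
      have h5 : 4 * (X * Y) ≤ 2 / 3 * (X * dA + Y * dB) := by
        have := div_le_div_of_nonneg_right h4 hd.le
        rw [mul_div_assoc, div_self hd.ne', mul_one] at this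
        calc 4 * (X * Y) ≤ 2 * (dA * dB) / 3 * (X * dA + Y * dB) / (dA * dB) := this
          _ = 2 / 3 * (X * dA + Y * dB) := by field_simp
      linarith
    have hZb' : 2 * X * Zb ≤ 2 * X * ((dA - 1) / 3) := by
      have : Zb ≤ (dA - 1) / 3 := by linarith
      nlinarith
    have hZa' : 2 * Za * Y ≤ 2 * ((dB - 1) / 3) * Y := by
      have : Za ≤ (dB - 1) / 3 := by linarith
      nlinarith
    nlinarith
  · -- not case 1: `3(X+Y) > 2 min(Δ_A, Δ_B)`, whence the bound on the deficit in terms of `|Δ_A − Δ_B|`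
    have hc_abs : 3 * (Za + Zb - X - Y) + 2 < |dA - dB| := by
      push Not at h1
      rcases le_total dA dB with h | h
      · have hXd : X * dA ≤ X * dB := mul_le_mul_of_nonneg_left h hX
        have h2 : 2 * dA < 3 * (X + Y) := by
          by_contra hn
          push Not at hn
          have : 3 * (X + Y) * dB ≤ 2 * dA * dB := mul_le_mul_of_nonneg_right hn hdB.le
          nlinarith
        rw [abs_sub_comm, abs_of_nonneg (by linarith : (0:ℝ) ≤ dB - dA)]
        linarith
      · have hYd : Y * dB ≤ Y * dA := mul_le_mul_of_nonneg_left h hY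
        have h2 : 2 * dB < 3 * (X + Y) := by
          by_contra hn
          push Not at hn
          have : 3 * (X + Y) * dA ≤ 2 * dB * dA := mul_le_mul_of_nonneg_right hn hdA.le
          nlinarith
        rw [abs_of_nonneg (by linarith : (0:ℝ) ≤ dA - dB)]
        linarith
    by_cases h2 : X ≤ Xb ∧ Y ≤ Yb
    · -- Case 2: flip `x_a ∪ x_b`
      left
      have hYb2 : 1 / 2 ≤ Yb - Zb := by linarith [h2.2]
      have hXb2 : 1 / 2 ≤ Xb - Za := by linarith [h2.1]
      have hP' : X * (Yb - Zb) + Y * (Xb - Za) ≤ P := by linarith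
      nlinarith [mul_le_mul_of_nonneg_left hYb2 hX, mul_le_mul_of_nonneg_left hXb2 hY]
    · by_cases h3 : Xb < X ∧ Yb < Y
      · -- Case 3: flip `x̄_a ∪ x̄_b`; here `c < -1`
        right
        have hX2 : 1 / 2 ≤ X - Za := by linarith [h3.1]
        have hY2 : 1 / 2 ≤ Y - Zb := by linarith [h3.2]
        have hQ' : Yb * (X - Za) + Xb * (Y - Zb) ≤ Q := by linarith
        have hQhalf : (Xb + Yb) / 2 ≤ Q := by
          nlinarith [mul_le_mul_of_nonneg_left hX2 hYb, mul_le_mul_of_nonneg_left hY2 hXb]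
        refine ⟨Or.inl (by linarith), by linarith, ?_⟩
        have : 3 * (Za + Zb - X - Y) + 2 < 0 := by linarith
        exact this.trans_le (abs_nonneg _)
      · -- Case 4: mixed signs
        have hmix : (X - Xb) * (Y - Yb) ≤ 0 := by
          by_cases hx : X ≤ Xb
          · have hy : Yb < Y := by
              by_contra hy
              push Not at hy
              exact h2 ⟨hx, hy⟩
            nlinarith [mul_nonneg (sub_nonneg.2 hx) (sub_nonneg.2 hy.le)]
          · push Not at hx
            have hy : Y ≤ Yb := by
              by_contra hy
              push Not at hy
              exact h3 ⟨hx, hy⟩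
            nlinarith [mul_nonneg (sub_nonneg.2 hx.le) (sub_nonneg.2 hy)]
        have hsum : dA + dB + 1 ≤ 3 * (P + Q) := by
          have h2XY : (X + Xb) * (Y + Yb) ≤ 2 * (X * Yb) + 2 * (Xb * Y) := by nlinarith
          have hPQ : 2 * (X * Yb) + 2 * (Xb * Y) - (X + Xb) * Zb - (Y + Yb) * Za ≤ P + Q := by
            nlinarith
          have hA : dB + 1 ≤ 2 * dB - 3 * Za := by linarith
          have hB : dA + 1 ≤ 2 * dA - 3 * Zb := by linarith
          have hprod : (dB + 1) * (dA + 1) ≤ (2 * dB - 3 * Za) * (2 * dA - 3 * Zb) := by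
            have h0' : 0 ≤ dA + 1 := by linarith
            calc (dB + 1) * (dA + 1) ≤ (2 * dB - 3 * Za) * (dA + 1) :=
                  mul_le_mul_of_nonneg_right hA h0'
              _ ≤ (2 * dB - 3 * Za) * (2 * dA - 3 * Zb) :=
                  mul_le_mul_of_nonneg_left hB (by linarith)
          have hXXb : X + Xb = dB - Za := by linarith
          have hYYb : Y + Yb = dA - Zb := by linarith
          rw [hXXb, hYYb] at hPQ h2XY
          nlinarith
        by_cases h4 : dA + dB + 1 ≤ 6 * P
        · left; linarith
        · have hQ6 : dA + dB + 1 ≤ 6 * Q := by linarith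
          right
          refine ⟨?_, by linarith, hc_abs⟩
          by_cases h5 : 2 * (Xb + Yb) ≤ dA + dB
          · left; linarith
          · right; linarith

/-! ### Two small facts about flips given by index parts -/

/-- The flip `{αa : α ∈ S} ∪ {bβ : β ∈ T}` and its complement in `g_{ba}` add up (as vectors of `𝔽₂^n`) to the
generator `g_{ba}` itself — "a vector equivalent modulo `C_Z^⊥` to `e + e₁` is `e + e₁'` with the support of `e₁'` being
[the complement]". [cite: LeverrierTillichZemor2015, App. B case 3 (arXiv v1 p0014 L7-9)] -/
theorem flipVec_parts_add_compl (H : Matrix B A (ZMod 2)) (b : B) (a : A) {S : Finset A} {T : Finset B}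
    (hS : S ⊆ nbrs Hᵀ b) (hT : T ⊆ nbrs H a) :
    flipVec (S.image (fun α' => (Sum.inl (α', a) : (A × A) ⊕ (B × B))) ∪ T.image (fun β' => Sum.inr (b, β')))
      + flipVec ((nbrs Hᵀ b \ S).image (fun α' => (Sum.inl (α', a) : (A × A) ⊕ (B × B)))
          ∪ (nbrs H a \ T).image (fun β' => Sum.inr (b, β')))
      = expanderHZ H (b, a) := by
  classical
  have h01 : ∀ z : ZMod 2, z ≠ 0 → z = 1 := by decide
  funext q
  rw [Pi.add_apply]
  rcases q with ⟨α, a'⟩ | ⟨b', β⟩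
  · rw [expanderHZ_row_apply_inl]
    simp only [flipVec, Finset.mem_union, Finset.mem_image, Finset.mem_sdiff, Sum.inl.injEq, Prod.mk.injEq,
      reduceCtorEq, and_false, exists_false, or_false]
    by_cases ha : a = a'
    · subst ha
      by_cases hα : H b α = 0
      · have hαS : α ∉ S := fun h => by
          have := mem_nbrs.1 (hS h); rw [Matrix.transpose_apply] at this; exact this hα
        have hαN : α ∉ nbrs Hᵀ b := fun h => by
          have := mem_nbrs.1 h; rw [Matrix.transpose_apply] at this; exact this hα
        simp [hαS, hαN, hα]
      · have hαN : α ∈ nbrs Hᵀ b := by rw [mem_nbrs, Matrix.transpose_apply]; exact hα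
        by_cases hαS : α ∈ S
        · simp [hαS, h01 _ hα]
        · simp [hαS, hαN, h01 _ hα]
    · simp [ha]
  · rw [expanderHZ_row_apply_inr]
    simp only [flipVec, Finset.mem_union, Finset.mem_image, Finset.mem_sdiff, Sum.inr.injEq, Prod.mk.injEq,
      reduceCtorEq, and_false, exists_false, false_or]
    by_cases hb : b = b'
    · subst hb
      by_cases hβ : H β a = 0
      · have hβT : β ∉ T := fun h => (mem_nbrs.1 (hT h)) hβ
        have hβN : β ∉ nbrs H a := fun h => (mem_nbrs.1 h) hβ
        simp [hβT, hβN, hβ]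
      · have hβN : β ∈ nbrs H a := by rw [mem_nbrs]; exact hβ
        by_cases hβT : β ∈ T
        · simp [hβT, h01 _ hβ]
        · simp [hβT, hβN, h01 _ hβ]
    · simp [hb]

omit [DecidableEq A] [DecidableEq B] in
/-- Weight of a flipped word: `|v ⊕ 𝟙_S| + 2|S ∩ supp v| = |v| + |S|`.
[cite: FawziGrospellierLeverrier2018, Lemma 21 proof eq. (synd decreasing) (arXiv v2 p0015 L33-36)] -/
theorem hammingNorm_add_flipVec {Q : Type*} [Fintype Q] [DecidableEq Q] (v : Q → ZMod 2) (S : Finset Q) :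
    hammingNorm (v + flipVec S) + 2 * (supp v ∩ S).card = hammingNorm v + S.card := by
  classical
  have h := SmallSetFlip.hammingNorm_add_add_two_mul_inter v (flipVec S)
  have hS : (univ.filter fun c => flipVec S c ≠ 0) = S := by
    ext q; simp [flipVec]
  rw [hS, hammingNorm_flipVec] at h
  simpa [supp] using h

/-! ### LTZ15 Lemma 8 with the weight clause -/

/-- **LTZ15 Lemma 8 with its reduced-weight clause — the form valid for all degrees, and the printed form for
near-balanced degrees.** For a `(Δ_A, Δ_B)`-biregular (`Δ ≥ 1`) `(γ_A, δ_A, γ_B, δ_B)`-expanding graph with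
`δ_A, δ_B < 1/6` and an error `e ∉ C_Z^⊥` with `|e| ≤ γ_A n_A`, `|e| ≤ γ_B n_B`, there are a small set `F` (a subset of a
generator) and a word `e'` of the coset `e + 𝟙_F + C_Z^⊥` such that
(i) `|F| ≤ 3(|σ_X(e)| − |σ_X(e ⊕ 𝟙_F)|)` ("flipping the `k` bits … decreases the syndrome weight by at least `k/3`") —
the PRINTED decrease clause, all degrees (also the tree's `exists_smallSet_decrease_third`);
(ii-weak) `|e'| ≤ |e| + 2(|σ_X(e)| − |σ_X(e ⊕ 𝟙_F)|) − 2` — OURS, NOT the printed statement (all degrees); and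
(ii) if `|Δ_A − Δ_B| ≤ 5` then `|e'| ≤ |e|` — the PRINTED clause "Moreover, `w_R(e+e₁) ≤ w_R(e)`" (take `e` of minimum
weight) under the ADDED hypothesis `|Δ_A − Δ_B| ≤ 5`, which is ours (it is what makes the printed case-4 step complete).
Proof as printed (Hamming-minimal representative, critical generator, eqs. (partial)/(partial2), four cases), the
representative of `e + 𝟙_F` being `e ⊕ 𝟙_F` itself when `F = x_a ∪ x_b ⊆ E`, and `e ⊕ 𝟙(x_a ∪ x_b ∪ χ_a ∪ χ_b)` (weight
`≤ |e| − |x_a ∪ x_b| + |χ_a ∪ χ_b|`) when `F` is `x̄_a ∪ x̄_b` or its complement; the deficit bounds are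
`ltz_four_cases_weight`. The printed clause for ALL degrees is not claimed (finding E-7).
[cite: LeverrierTillichZemor2015, Lemma 8 (arXiv v1 p0008 L104-114) and App. B (p0013 L10 – p0014 L65)] -/
theorem exists_smallSet_decrease_third_weight (H : Matrix B A (ZMod 2)) {dA dB : ℕ} {γA δA γB δB : ℝ}
    (hreg : IsBiregular H dA dB) (hexp : IsLeftRightExpanding H dA dB γA δA γB δB)
    (hdA : 0 < dA) (hdB : 0 < dB) (hδA : 0 < δA) (hδA' : δA < 1 / 6) (hδB : 0 < δB) (hδB' : δB < 1 / 6)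
    (e : (A × A) ⊕ (B × B) → ZMod 2) (he : e ∉ rowSpace (expanderHZ H))
    (hwA : (hammingNorm e : ℝ) ≤ γA * Fintype.card A) (hwB : (hammingNorm e : ℝ) ≤ γB * Fintype.card B) :
    ∃ F ∈ smallSets (expanderHZ H), ∃ e' : (A × A) ⊕ (B × B) → ZMod 2,
      (F.card : ℝ) ≤ 3 * syndromeDecrease (expanderHX H) (expanderHX H *ᵥ e) F ∧
      e' - (e + flipVec F) ∈ rowSpace (expanderHZ H) ∧
      (hammingNorm e' : ℝ) ≤ hammingNorm e + 2 * syndromeDecrease (expanderHX H) (expanderHX H *ᵥ e) F - 2 ∧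
      (|(dA : ℝ) - dB| ≤ 5 → hammingNorm e' ≤ hammingNorm e) := by
  classical
  -- Hamming-minimal representative of the coset
  obtain ⟨eR, heR, hmin⟩ := exists_wnorm_min (expanderHZ H) hammingNorm e
  have hsyn : expanderHX H *ᵥ eR = expanderHX H *ᵥ e := by
    have h0 := expanderHX_mulVec_eq_zero_of_mem_rowSpace H heR
    rw [Matrix.mulVec_sub, sub_eq_zero] at h0
    exact h0
  have heR_not : eR ∉ rowSpace (expanderHZ H) := by
    intro h
    apply he
    have : e = eR - (eR - e) := by abel
    rw [this]
    exact Submodule.sub_mem _ h heR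
  have heR0 : (supp eR).Nonempty := by
    by_contra h0
    rw [Finset.not_nonempty_iff_eq_empty] at h0
    apply heR_not
    have hz : eR = 0 := by
      ext q
      by_contra hq
      have : q ∈ supp eR := by simpa [supp] using hq
      rw [h0] at this
      exact Finset.notMem_empty _ this
    rw [hz]; exact Submodule.zero_mem _
  have hsupp : (supp eR).card = hammingNorm eR := by simp [supp, hammingNorm]
  have hle : hammingNorm eR ≤ hammingNorm e := hmin e (by simp)
  have hcardA : ((supp eR).card : ℝ) ≤ γA * Fintype.card A := by
    rw [hsupp]; exact le_trans (by exact_mod_cast hle) hwA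
  have hcardB : ((supp eR).card : ℝ) ≤ γB * Fintype.card B := by
    rw [hsupp]; exact le_trans (by exact_mod_cast hle) hwB
  -- critical generator
  obtain ⟨b, a, Χa, Χb, hc⟩ :=
    exists_isCritical H hreg hexp hdA hdB hδA.le hδB.le (supp eR) heR0 hcardA hcardB
  -- the index sets
  set Xa := critX H eR b a Χa with hXa
  set Yb := critY H eR b a Χb with hYb
  set Xbar := (nbrs Hᵀ b \ Χa).filter fun α => eR (Sum.inl (α, a)) = 0 with hXbar
  set Ybar := (nbrs H a \ Χb).filter fun β => eR (Sum.inr (b, β)) = 0 with hYbar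
  have hXbar_sub : Xbar ⊆ nbrs Hᵀ b := fun α h => (Finset.mem_sdiff.1 (Finset.mem_filter.1 h).1).1
  have hYbar_sub : Ybar ⊆ nbrs H a := fun β h => (Finset.mem_sdiff.1 (Finset.mem_filter.1 h).1).1
  -- row / column sums
  have hXbar' : (nbrs Hᵀ b \ Χa).filter (fun α => ¬ (eR (Sum.inl (α, a)) ≠ 0)) = Xbar :=
    Finset.filter_congr (fun α _ => by rw [not_not])
  have hYbar' : (nbrs H a \ Χb).filter (fun β => ¬ (eR (Sum.inr (b, β)) ≠ 0)) = Ybar :=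
    Finset.filter_congr (fun β _ => by rw [not_not])
  have hΧa_le : Χa.card ≤ dB := by
    have := Finset.card_le_card hc.Χa_subset; rwa [card_nbrs_transpose_eq H hreg b] at this
  have hΧb_le : Χb.card ≤ dA := by
    have := Finset.card_le_card hc.Χb_subset; rwa [card_nbrs_eq H hreg a] at this
  have hrowN : Xa.card + Xbar.card + Χa.card = dB := by
    have h1 : Xa.card + Xbar.card = (nbrs Hᵀ b \ Χa).card := by
      rw [← hXbar', hXa, critX]; exact Finset.card_filter_add_card_filter_not _
    have h2 : (nbrs Hᵀ b \ Χa).card = dB - Χa.card := by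
      rw [Finset.card_sdiff_of_subset hc.Χa_subset, card_nbrs_transpose_eq H hreg b]
    omega
  have hcolN : Yb.card + Ybar.card + Χb.card = dA := by
    have h1 : Yb.card + Ybar.card = (nbrs H a \ Χb).card := by
      rw [← hYbar', hYb, critY]; exact Finset.card_filter_add_card_filter_not _
    have h2 : (nbrs H a \ Χb).card = dA - Χb.card := by
      rw [Finset.card_sdiff_of_subset hc.Χb_subset, card_nbrs_eq H hreg a]
    omega
  have hrow : (Xa.card : ℝ) + Xbar.card + Χa.card = dB := by exact_mod_cast hrowN
  have hcol : (Yb.card : ℝ) + Ybar.card + Χb.card = dA := by exact_mod_cast hcolN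
  -- integrality of the `χ` bounds: `3|χ_a| + 1 ≤ Δ_B`
  have hZa3 : 3 * (Χa.card : ℝ) + 1 ≤ dB := by
    have h1 : (Χa.card : ℝ) ≤ 2 * δB * dB := hc.card_Χa_le
    have h2 : (3 * Χa.card : ℝ) < dB := by nlinarith [(show (0:ℝ) < dB by exact_mod_cast hdB)]
    have h3 : 3 * Χa.card < dB := by exact_mod_cast h2
    have h4 : 3 * Χa.card + 1 ≤ dB := h3
    exact_mod_cast h4
  have hZb3 : 3 * (Χb.card : ℝ) + 1 ≤ dA := by
    have h1 : (Χb.card : ℝ) ≤ 2 * δA * dA := hc.card_Χb_le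
    have h2 : (3 * Χb.card : ℝ) < dA := by nlinarith [(show (0:ℝ) < dA by exact_mod_cast hdA)]
    have h3 : 3 * Χb.card < dA := by exact_mod_cast h2
    have h4 : 3 * Χb.card + 1 ≤ dA := h3
    exact_mod_cast h4
  -- reducedness: `2 (|x_a| + |x_b|) ≤ Δ_A + Δ_B`
  have hred : 2 * ((Xa.card : ℝ) + Yb.card) ≤ dA + dB := by
    have hA := cardA_add_row H hreg eR b a
    have hB := cardB_add_row H hreg eR b a
    have hmin' : hammingNorm eR ≤ hammingNorm (eR + expanderHZ H (b, a)) := by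
      refine hmin _ ?_
      have : eR + expanderHZ H (b, a) - e = (eR - e) + expanderHZ H (b, a) := by abel
      rw [this]; exact Submodule.add_mem _ heR (expanderHZ_row_mem_rowSpace H b a)
    have hn1 : hammingNorm eR = (univ.filter fun p : A × A => eR (Sum.inl p) ≠ 0).card
        + (univ.filter fun p : B × B => eR (Sum.inr p) ≠ 0).card := by
      simp only [hammingNorm]
      rw [Finset.card_filter, Finset.card_filter, Finset.card_filter, Fintype.sum_sum_type]
    have hn2 : hammingNorm (eR + expanderHZ H (b, a))
        = (univ.filter fun p : A × A => (eR + expanderHZ H (b, a)) (Sum.inl p) ≠ 0).card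
        + (univ.filter fun p : B × B => (eR + expanderHZ H (b, a)) (Sum.inr p) ≠ 0).card := by
      simp only [hammingNorm]
      rw [Finset.card_filter, Finset.card_filter, Finset.card_filter, Fintype.sum_sum_type]
    rw [hn1, hn2] at hmin'
    have hXle : Xa.card ≤ ((nbrs Hᵀ b).filter fun α => eR (Sum.inl (α, a)) ≠ 0).card := by
      refine Finset.card_le_card fun α hα => ?_
      rw [hXa, mem_critX] at hα
      rw [Finset.mem_filter, mem_nbrs, Matrix.transpose_apply]
      exact ⟨hα.1.1, hα.2⟩
    have hYle : Yb.card ≤ ((nbrs H a).filter fun β => eR (Sum.inr (b, β)) ≠ 0).card := by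
      refine Finset.card_le_card fun β hβ => ?_
      rw [hYb, mem_critY] at hβ
      rw [Finset.mem_filter, mem_nbrs]
      exact ⟨hβ.1.1, hβ.2⟩
    have : 2 * (Xa.card + Yb.card) ≤ dA + dB := by omega
    exact_mod_cast this
  -- the two decrease bounds
  have hP := syndromeDecrease_critFlip_ge hreg hc
  rw [hsyn] at hP
  have hQ := syndromeDecrease_flipBar_ge hc
  rw [hsyn] at hQ
  set F := critFlip H eR b a Χa Χb with hF
  set G := Xbar.image (fun α' => (Sum.inl (α', a) : (A × A) ⊕ (B × B)))
    ∪ Ybar.image (fun β' => Sum.inr (b, β')) with hG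
  set G' := (nbrs Hᵀ b \ Xbar).image (fun α' => (Sum.inl (α', a) : (A × A) ⊕ (B × B)))
    ∪ (nbrs H a \ Ybar).image (fun β' => Sum.inr (b, β')) with hG'
  set P : ℝ := ((syndromeDecrease (expanderHX H) (expanderHX H *ᵥ e) F : ℤ) : ℝ) with hPdef
  set Q : ℝ := ((syndromeDecrease (expanderHX H) (expanderHX H *ᵥ e) G : ℤ) : ℝ) with hQdef
  have hP' : (Xa.card : ℝ) * Ybar.card + Xbar.card * Yb.card - Xa.card * Χb.card - Χa.card * Yb.card ≤ P := by
    have h1 : ((Xa.card : ℤ) * ((dA : ℤ) - Χb.card - Yb.card) + ((dB : ℤ) - Χa.card - Xa.card) * Yb.card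
        - Xa.card * Χb.card - Χa.card * Yb.card : ℝ)
        ≤ (syndromeDecrease (expanderHX H) (expanderHX H *ᵥ e) F : ℝ) := by exact_mod_cast hP
    have hYbar_e : (Ybar.card : ℝ) = dA - Χb.card - Yb.card := by linarith
    have hXbar_e : (Xbar.card : ℝ) = dB - Χa.card - Xa.card := by linarith
    rw [hPdef, hYbar_e, hXbar_e]
    push_cast at h1
    linarith
  have hQ' : (Xa.card : ℝ) * Ybar.card + Xbar.card * Yb.card - Xbar.card * Χb.card - Χa.card * Ybar.card
      ≤ Q := by
    rw [hQdef]; exact_mod_cast hQ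
  -- `x_a ∪ x_b ≠ ∅` and `x̄_a ∪ x̄_b ≠ ∅`
  have hposN : 1 ≤ Xa.card + Yb.card := by
    have h := card_critFlip H eR b a Χa Χb
    have hne := critFlip_nonempty hc
    have : 0 < (critFlip H eR b a Χa Χb).card := Finset.card_pos.2 hne
    rw [h] at this
    rw [hXa, hYb]; omega
  have hpos : (1 : ℝ) ≤ Xa.card + Yb.card := by exact_mod_cast hposN
  have hbar_pos : (1 : ℝ) ≤ Xbar.card + Ybar.card := by
    by_contra hlt
    push Not at hlt
    have h0 : Xbar.card + Ybar.card = 0 := by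
      by_contra hne
      have : 1 ≤ Xbar.card + Ybar.card := Nat.one_le_iff_ne_zero.2 hne
      have : (1 : ℝ) ≤ Xbar.card + Ybar.card := by exact_mod_cast this
      linarith
    have hXb0 : (Xbar.card : ℝ) = 0 := by exact_mod_cast (by omega : Xbar.card = 0)
    have hYb0 : (Ybar.card : ℝ) = 0 := by exact_mod_cast (by omega : Ybar.card = 0)
    nlinarith
  -- the case analysis with the weight bookkeeping
  have hcases := ltz_four_cases_weight (P := P) (Q := Q) (by exact_mod_cast hdA) (by exact_mod_cast hdB)
    (Nat.cast_nonneg Xa.card) (Nat.cast_nonneg Xbar.card) (Nat.cast_nonneg Yb.card)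
    (Nat.cast_nonneg Ybar.card) hrow hcol hZa3 hZb3 hred hpos hP' hQ'
  -- sizes of the three candidates
  have hcardF : (F.card : ℝ) = Xa.card + Yb.card := by
    rw [hF]; exact_mod_cast card_critFlip H eR b a Χa Χb
  have hcardGN : G.card = Xbar.card + Ybar.card := by rw [hG]; exact card_flipVec_parts b a Xbar Ybar
  have hcardG : (G.card : ℝ) = Xbar.card + Ybar.card := by exact_mod_cast hcardGN
  have hXbar_le : Xbar.card ≤ dB := by
    have := Finset.card_le_card hXbar_sub; rwa [card_nbrs_transpose_eq H hreg b] at this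
  have hYbar_le : Ybar.card ≤ dA := by
    have := Finset.card_le_card hYbar_sub; rwa [card_nbrs_eq H hreg a] at this
  have hcardG'N : G'.card = (dB - Xbar.card) + (dA - Ybar.card) := by
    have h1 := card_flipVec_parts (A := A) (B := B) b a (nbrs Hᵀ b \ Xbar) (nbrs H a \ Ybar)
    rw [Finset.card_sdiff_of_subset hXbar_sub, Finset.card_sdiff_of_subset hYbar_sub,
      card_nbrs_transpose_eq H hreg b, card_nbrs_eq H hreg a] at h1
    rw [hG']; exact h1
  have hcardG' : (G'.card : ℝ) = dA + dB - Xbar.card - Ybar.card := by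
    rw [hcardG'N, Nat.cast_add, Nat.cast_sub hXbar_le, Nat.cast_sub hYbar_le]; ring
  have hQG' : (syndromeDecrease (expanderHX H) (expanderHX H *ᵥ e) G' : ℝ) = Q := by
    rw [hQdef, hG', hG]
    exact_mod_cast syndromeDecrease_parts_compl H b a (expanderHX H *ᵥ e) hXbar_sub hYbar_sub
  -- the weight witnesses: `eR ⊕ 𝟙_F` (first branch) and `eR ⊕ 𝟙_{G'}` (second branch)
  have hFsub : F ⊆ supp eR := by rw [hF]; exact critFlip_subset_supp H eR b a Χa Χb
  have hwF : hammingNorm (eR + flipVec F) + F.card = hammingNorm eR := by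
    have h := hammingNorm_add_flipVec eR F
    rw [Finset.inter_eq_right.2 hFsub] at h
    omega
  -- `x_a ∪ x_b ⊆ G'` and `⊆ supp eR`, so `|eR ⊕ 𝟙_{G'}| ≤ |eR| + |G'| − 2|x_a ∪ x_b|`
  have hFG' : F ⊆ G' := by
    intro q hq
    rw [hF] at hq
    rw [hG', Finset.mem_union]
    rcases q with ⟨α, a'⟩ | ⟨b', β⟩
    · obtain ⟨rfl, hα⟩ := inl_mem_critFlip.1 hq
      left
      refine Finset.mem_image.2 ⟨α, Finset.mem_sdiff.2 ⟨?_, fun h => ?_⟩, rfl⟩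
      · rw [mem_nbrs, Matrix.transpose_apply]; exact (mem_critX.1 hα).1.1
      · exact (mem_critX.1 hα).2 (Finset.mem_filter.1 h).2
    · obtain ⟨rfl, hβ⟩ := inr_mem_critFlip.1 hq
      right
      refine Finset.mem_image.2 ⟨β, Finset.mem_sdiff.2 ⟨?_, fun h => ?_⟩, rfl⟩
      · exact mem_nbrs.2 (mem_critY.1 hβ).1.1
      · exact (mem_critY.1 hβ).2 (Finset.mem_filter.1 h).2
  have hwG'N : hammingNorm (eR + flipVec G') + 2 * F.card ≤ hammingNorm eR + G'.card := by
    have h := hammingNorm_add_flipVec eR G'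
    have hsub : F ⊆ supp eR ∩ G' := Finset.subset_inter hFsub hFG'
    have := Finset.card_le_card hsub
    omega
  -- in terms of the deficit `c = |χ_a| + |χ_b| − |x_a| − |x_b|`
  have hwG' : (hammingNorm (eR + flipVec G') : ℝ)
      ≤ hammingNorm eR + (Χa.card + Χb.card - Xa.card - Yb.card) := by
    have h1 : (hammingNorm (eR + flipVec G') : ℝ) + 2 * F.card ≤ hammingNorm eR + G'.card := by
      exact_mod_cast hwG'N
    rw [hcardG', hcardF] at h1
    linarith
  -- coset bookkeeping: `𝟙_G + 𝟙_{G'} = g_{ba}`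
  have hGG' : flipVec G + flipVec G' = expanderHZ H (b, a) := by
    rw [hG, hG']; exact flipVec_parts_add_compl H b a hXbar_sub hYbar_sub
  rcases hcases with h | ⟨h, hc6, hcabs⟩
  · -- first branch: `F = x_a ∪ x_b ⊆ E`
    refine ⟨F, critFlip_mem_smallSets hc, eR + flipVec F, by rw [hcardF]; linarith, ?_, ?_, fun _ => ?_⟩
    · have : eR + flipVec F - (e + flipVec F) = eR - e := by abel
      rw [this]; exact heR
    · -- `|eR ⊕ 𝟙_F| = |eR| − |F| ≤ |e| − 1` and `P ≥ |F|/3 > 0` is an integer, so `2P − 2 ≥ 0`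
      have hF1 : (1 : ℝ) ≤ F.card := by rw [hcardF]; exact hpos
      have hP1 : (1 : ℝ) ≤ P := by
        have h0 : (0 : ℝ) < P := by linarith
        have h0' : (0 : ℤ) < syndromeDecrease (expanderHX H) (expanderHX H *ᵥ e) F := by
          rw [hPdef] at h0; exact_mod_cast h0
        have : (1 : ℤ) ≤ syndromeDecrease (expanderHX H) (expanderHX H *ᵥ e) F := h0'
        rw [hPdef]; exact_mod_cast this
      have h1 : (hammingNorm (eR + flipVec F) : ℝ) + F.card = hammingNorm eR := by exact_mod_cast hwF
      have h2 : (hammingNorm eR : ℝ) ≤ hammingNorm e := by exact_mod_cast hle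
      rw [← hPdef]  -- no-op safeguard
      linarith
    · have := hwF; omega
  · -- second branch: `G = x̄_a ∪ x̄_b` or its complement `G'`, witness `eR ⊕ 𝟙_{G'}`
    -- integrality: the deficit is an integer `< 1` when `|Δ_A − Δ_B| ≤ 5`, and `≤ 2Q − 2` always
    have hQwt : (hammingNorm (eR + flipVec G') : ℝ) ≤ hammingNorm e + 2 * Q - 2 := by
      have h2 : (hammingNorm eR : ℝ) ≤ hammingNorm e := by exact_mod_cast hle
      linarith
    have hbal : |(dA : ℝ) - dB| ≤ 5 → hammingNorm (eR + flipVec G') ≤ hammingNorm e := by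
      intro hb
      have hlt : ((Χa.card + Χb.card : ℕ) : ℝ) < (Xa.card + Yb.card : ℕ) + 1 := by
        push_cast; linarith
      have hle' : Χa.card + Χb.card ≤ Xa.card + Yb.card := by
        have : (Χa.card + Χb.card : ℕ) < Xa.card + Yb.card + 1 := by exact_mod_cast hlt
        omega
      have h3 : (hammingNorm (eR + flipVec G') : ℝ) ≤ hammingNorm eR := by
        have : ((Χa.card : ℝ) + Χb.card - Xa.card - Yb.card) ≤ 0 := by
          have : ((Χa.card + Χb.card : ℕ) : ℝ) ≤ ((Xa.card + Yb.card : ℕ) : ℝ) := by exact_mod_cast hle'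
          push_cast at this; linarith
        linarith
      have h4 : hammingNorm (eR + flipVec G') ≤ hammingNorm eR := by exact_mod_cast h3
      exact h4.trans hle
    rcases h with h | h
    · -- flip `G = x̄_a ∪ x̄_b`
      refine ⟨G, ?_, eR + flipVec G', by rw [hcardG]; linarith, ?_, by rw [← hQdef]; exact hQwt, hbal⟩
      · refine flipVec_parts_mem_smallSets H b a hXbar_sub hYbar_sub ?_
        by_contra hne
        rw [not_or, Finset.not_nonempty_iff_eq_empty, Finset.not_nonempty_iff_eq_empty] at hne
        rw [hne.1, hne.2] at hbar_pos
        norm_num at hbar_pos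
      · -- `(eR + 𝟙_{G'}) − (e + 𝟙_G) = (eR − e) + g_{ba}` in characteristic 2
        have h1 : eR + flipVec G' - (e + flipVec G) = (eR - e) + (flipVec G + flipVec G') := by
          have h2 : (flipVec G : (A × A) ⊕ (B × B) → ZMod 2) + flipVec G = 0 := by
            funext q; rw [Pi.add_apply, Pi.zero_apply]; exact (by decide : ∀ z : ZMod 2, z + z = 0) _
          calc eR + flipVec G' - (e + flipVec G)
              = (eR - e) + (flipVec G + flipVec G') - (flipVec G + flipVec G) := by abel
            _ = (eR - e) + (flipVec G + flipVec G') := by rw [h2, sub_zero]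
        rw [h1, hGG']
        exact Submodule.add_mem _ heR (expanderHZ_row_mem_rowSpace H b a)
    · -- flip the complement `G'`
      refine ⟨G', ?_, eR + flipVec G', by rw [hQG', hcardG']; linarith, ?_, by rw [hQG']; exact hQwt, hbal⟩
      · refine flipVec_parts_mem_smallSets H b a Finset.sdiff_subset Finset.sdiff_subset ?_
        rcases hc.nonempty with ⟨α, hα, hE⟩ | ⟨β, hβ, hE⟩
        · left
          refine ⟨α, Finset.mem_sdiff.2 ⟨(Finset.mem_sdiff.1 hα).1, fun h => ?_⟩⟩
          have := (Finset.mem_filter.1 h).2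
          have hne : eR (Sum.inl (α, a)) ≠ 0 := by simpa [supp] using hE
          exact hne this
        · right
          refine ⟨β, Finset.mem_sdiff.2 ⟨(Finset.mem_sdiff.1 hβ).1, fun h => ?_⟩⟩
          have := (Finset.mem_filter.1 h).2
          have hne : eR (Sum.inr (b, β)) ≠ 0 := by simpa [supp] using hE
          exact hne this
      · have : eR + flipVec G' - (e + flipVec G') = eR - e := by abel
        rw [this]; exact heR

end QuantumExpander

end Literature.InformationTheory.QuantumCodes
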